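import Summits.Ventures.HSemireg.WedgeHankelDivisorRank
import Summits.Ventures.HSemireg.WedgeHankelConfluentRank
import Summits.Ventures.HSemireg.WedgeHankelSecantSiegel

/-!
# Venture HSemireg — THE DIVISOR RANK LAW, FULL-ROW-RANK REGIME: `rank H_k(Σ_i exp(λ_i Θ)·p_i(Θ)) = k + 1` for total order
# `k + 1 ≤ Σ_i (P_i + 1) ≤ n + 1 − k`, hence `rank H_k = min(Σ_i (P_i+1), k+1)` and the kernel is the Siegel ideal `SI_k` there

HONEST FRAMING. Part of the Lean index of the computation cell `pub-hsemireg` (seat p10 gen 16, Sunday typer «UNIFORM-IN-n»).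
LINEAR ALGEBRA OF HANKEL MATRICES + th-7's finite-dimensional exterior-algebra model over a field ONLY: no variety, no cohomology theory, no sheaf, no Ext group,
no semiregularity map; nothing here says that HC / HC_CM / HC_AV holds; no Literature fact is declared or used.  Custodian versions as in `WedgeHankelSiegelIdeal`
(1/3) and `WedgeHankelFrameChange`; the dictionary (divisor `Σ_i (P_i+1)[λ_i]` of the class `Σ_i exp(λ_i Θ)·p_i(Θ)`) is QUOTED, never asserted.

WHAT IS IN THE TREE / KEYED.  F2a `WedgeHankelDivisorRank`: `H_k = (cvMat (k+1))ᵀ · hkMat · cvMat (n+1−k)`, `(cvMat c)ᵀ` injective and `cvMat c` onto for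
`D = Σ_i (P_i+1) ≤ c`, and the rank law `rank H_k = D` for `D ≤ min(k+1, n+1−k)`; D1/D3 (simple nodes): `rank = k + 1` and `Kr = SI_k` for `k + 1 ≤ r ≤ n + 1 − k`
(a Vandermonde minor on the first `k + 1` nodes).  THIS FILE does the regime `D ≥ k + 1` WITH multiplicities, without choosing a sub-divisor:
* §55 COLUMN TRUNCATION: `cvMat c` is the first `c` columns of the SQUARE `cvMat D`, which is injective (its transpose is injective, F2a), so **`cvMat c` is
  injective for every `c ≤ D`** (`cvMat_mulVecLin_injective`) — a non-zero polynomial of degree `< D` cannot vanish on a divisor of total order `D`, in th-7's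
  sequence vocabulary; `hkMat q` is onto for exact orders (square + injective).
* §56 **`rank_hankel1_expMul_sum_of_le`: `rank H_k(Σ_i expMul λ_i q_i) = k + 1` for distinct `λ_i`, exact orders `P_i`, `k + 1 ≤ D ≤ n + 1 − k`**; with F2a:
  **`rank_hankel1_expMul_sum_eq_min`: `rank H_k = min(D, k + 1)` whenever `D ≤ n + 1 − k`**; and the kernel: **`Kr_w_expMul_sum_eq_siegelIdeal`: `Kr(univ, w_n(Σ_i
  expMul λ_i q_i), k) = SI_k`** in that regime (gen 11's full-rank criterion, by D3's containment + equal numbers) — the generic kernel, whatever the divisor.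
NOT typed here: a node at `∞` among the nodes; the degrees with `D > n + 1 − k`.  Namespace `Summit.Ventures.HSemireg.Wedge.HankelFrameChange` (continued).
-/

open Module
open scoped Matrix

namespace Summit.Ventures.HSemireg.Wedge.HankelFrameChange

open Summit.Ventures.HSemireg.Wedge Summit.Ventures.HSemireg.Wedge.Kunneth Summit.Ventures.HSemireg.Wedge.Hankel
  Summit.Ventures.HSemireg.Wedge.HankelSiegel Summit.Ventures.HSemireg.Wedge.HankelSiegelIdeal Summit.Ventures.HSemireg.Wedge.KunnethKernel
  Summit.Ventures.HSemireg.Wedge.HankelSecant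

variable (K : Type*) [Field K] {n : ℕ}

/-! ## §55. Column truncation: `cvMat c` is injective for `c ≤ D`; `hkMat` is onto -/

/-- **THE SQUARE CONFLUENT NODE MATRIX IS INJECTIVE**: `cvMat D` (`D = Σ_i (P_i+1)` columns) has trivial kernel — its transpose is injective (F2a) and it is square. -/
theorem cvMat_mulVecLin_injective_sq {r : ℕ} {lam : Fin r → K} (hlam : Function.Injective lam) (P : Fin r → ℕ) :
    Function.Injective (cvMat K lam P (∑ i, (P i + 1))).mulVecLin := by
  rw [← LinearMap.ker_eq_bot, ← Submodule.finrank_eq_zero]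
  have h1 := LinearMap.finrank_range_add_finrank_ker (cvMat K lam P (∑ i, (P i + 1))).mulVecLin
  have h2 : finrank K (LinearMap.range (cvMat K lam P (∑ i, (P i + 1))).mulVecLin) = ∑ i, (P i + 1) := by
    rw [← Matrix.rank]; exact rank_cvMat K hlam P le_rfl
  rw [h2, finrank_fintype_fun_eq_card, Fintype.card_fin] at h1
  omega

/-- the first `c` columns: `cvMat c = (cvMat D)` restricted along `Fin.castLE`. -/
lemma cvMat_castLE {r : ℕ} (lam : Fin r → K) (P : Fin r → ℕ) {c D : ℕ} (h : c ≤ D) (x : DIdx P) (l : Fin c) :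
    cvMat K lam P c x l = cvMat K lam P D x (Fin.castLE h l) := rfl

/-- **`cvMat c` IS INJECTIVE FOR EVERY `c ≤ D`** (zero-extend a kernel vector to `K^D`). -/
theorem cvMat_mulVecLin_injective {r : ℕ} {lam : Fin r → K} (hlam : Function.Injective lam) (P : Fin r → ℕ) {c : ℕ}
    (hc : c ≤ ∑ i, (P i + 1)) : Function.Injective (cvMat K lam P c).mulVecLin := by
  rw [← LinearMap.ker_eq_bot, LinearMap.ker_eq_bot']
  intro v hv
  set D := ∑ i, (P i + 1) with hD
  -- zero-extension of v to Fin D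
  set v' : Fin D → K := fun l => if h : (l : ℕ) < c then v ⟨l, h⟩ else 0 with hv'
  have hext : (cvMat K lam P D).mulVecLin v' = (cvMat K lam P c).mulVecLin v := by
    funext x
    rw [Matrix.mulVecLin_apply, Matrix.mulVecLin_apply, Matrix.mulVec, Matrix.mulVec, dotProduct, dotProduct]
    have hsub : (Finset.univ.map (Fin.castLEEmb hc) : Finset (Fin D)) ⊆ Finset.univ := Finset.subset_univ _
    rw [← Finset.sum_subset hsub, Finset.sum_map]
    · refine Finset.sum_congr rfl fun l _ => ?_
      rw [Fin.castLEEmb_apply, ← cvMat_castLE K lam P hc]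
      simp only [hv', Fin.val_castLE, dif_pos l.2, Fin.eta]
    · intro l _ hl
      have hlc : ¬ (l : ℕ) < c := fun hlt => hl (Finset.mem_map.mpr ⟨⟨l, hlt⟩, Finset.mem_univ _, Fin.ext rfl⟩)
      simp only [hv', dif_neg hlc, mul_zero]
  have hz : v' = 0 := by
    apply cvMat_mulVecLin_injective_sq K hlam P
    rw [hext, hv, map_zero]
  funext l
  have := congrFun hz (Fin.castLE hc l)
  simpa only [hv', Fin.val_castLE, dif_pos l.2, Fin.eta, Pi.zero_apply] using this

/-- **`hkMat q` IS ONTO for exact orders** (square and injective, F2a). -/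
theorem range_hkMat_mulVecLin_eq_top {r : ℕ} (P : Fin r → ℕ) {q : Fin r → ℕ → K} (hq : ∀ i j, P i < j → q i j = 0)
    (hqP : ∀ i, q i (P i) ≠ 0) : LinearMap.range (hkMat K P q).mulVecLin = ⊤ :=
  LinearMap.range_eq_top.mpr (LinearMap.injective_iff_surjective.mp (hkMat_mulVecLin_injective K P hq hqP))

/-! ## §56. The full-row-rank regime and the generic kernel -/

/-- **`rank H_k(Σ_i expMul λ_i q_i) = k + 1` (full row rank) for `k + 1 ≤ D ≤ n + 1 − k`**, `D = Σ_i (P_i + 1)`, distinct nodes, exact orders. -/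
theorem rank_hankel1_expMul_sum_of_le {k r : ℕ} {lam : Fin r → K} (hlam : Function.Injective lam) {P : Fin r → ℕ} {q : Fin r → ℕ → K}
    (hq : ∀ i j, P i < j → q i j = 0) (hqP : ∀ i, q i (P i) ≠ 0) (hkD : k + 1 ≤ ∑ i, (P i + 1)) (hDn : ∑ i, (P i + 1) ≤ n + 1 - k) :
    (hankel1 K n k (fun j => ∑ i, expMul K (lam i) (q i) j)).rank = k + 1 := by
  rw [hankel1_expMul_sum K n k lam hq, Matrix.rank, Matrix.mulVecLin_mul,
    LinearMap.range_comp_of_range_eq_top _ (range_cvMat_mulVecLin_eq_top K hlam P hDn), Matrix.mulVecLin_mul,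
    LinearMap.range_comp_of_range_eq_top _ (range_hkMat_mulVecLin_eq_top K P hq hqP), ← Matrix.rank, Matrix.rank_transpose, Matrix.rank,
    LinearMap.finrank_range_of_inj (cvMat_mulVecLin_injective K hlam P hkD), finrank_fintype_fun_eq_card, Fintype.card_fin]

/-- **THE DIVISOR RANK LAW, BOTH REGIMES: `rank H_k(Σ_i expMul λ_i q_i) = min(Σ_i (P_i+1), k + 1)` whenever `Σ_i (P_i+1) ≤ n + 1 − k`.** -/
theorem rank_hankel1_expMul_sum_eq_min {k r : ℕ} {lam : Fin r → K} (hlam : Function.Injective lam) {P : Fin r → ℕ} {q : Fin r → ℕ → K}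
    (hq : ∀ i j, P i < j → q i j = 0) (hqP : ∀ i, q i (P i) ≠ 0) (hDn : ∑ i, (P i + 1) ≤ n + 1 - k) :
    (hankel1 K n k (fun j => ∑ i, expMul K (lam i) (q i) j)).rank = min (∑ i, (P i + 1)) (k + 1) := by
  rcases le_total (∑ i, (P i + 1)) (k + 1) with h | h
  · rw [min_eq_left h]; exact rank_hankel1_expMul_sum K hlam hq hqP h hDn
  · rw [min_eq_right h]; exact rank_hankel1_expMul_sum_of_le K hlam hq hqP h hDn

/-- the kernel number in the full-row-rank regime: **`dim Kr + (k+1)·C(n,k) = C(2n,k)`**. -/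
theorem finrank_Kr_w_expMul_sum_add_of_le {k r : ℕ} {lam : Fin r → K} (hlam : Function.Injective lam) {P : Fin r → ℕ} {q : Fin r → ℕ → K}
    (hq : ∀ i j, P i < j → q i j = 0) (hqP : ∀ i, q i (P i) ≠ 0) (hkD : k + 1 ≤ ∑ i, (P i + 1)) (hDn : ∑ i, (P i + 1) ≤ n + 1 - k) :
    finrank K (Kr K Finset.univ (w K n n (fun j => ∑ i, expMul K (lam i) (q i) j)) k) + (k + 1) * n.choose k = (n + n).choose k := by
  have h := finrank_Kr_w_add_rank K (n := n) k (fun j => ∑ i, expMul K (lam i) (q i) j)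
  rw [rank_hankel1_expMul_sum_of_le K hlam hq hqP hkD hDn, Nat.mul_comm] at h
  exact h

/-- **THE GENERIC KERNEL: `Kr(univ, w_n(Σ_i expMul λ_i q_i), k) = SI_k` for `k + 1 ≤ Σ_i (P_i+1) ≤ n + 1 − k`** (distinct nodes, exact orders) — a divisor of
total order at least `k + 1` is killed in degree `k` by the Siegel ideal only (D3's `Kr_w_secSeq_eq_siegelIdeal` for simple nodes). -/
theorem Kr_w_expMul_sum_eq_siegelIdeal {k r : ℕ} {lam : Fin r → K} (hlam : Function.Injective lam) {P : Fin r → ℕ} {q : Fin r → ℕ → K}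
    (hq : ∀ i j, P i < j → q i j = 0) (hqP : ∀ i, q i (P i) ≠ 0) (hkD : k + 1 ≤ ∑ i, (P i + 1)) (hDn : ∑ i, (P i + 1) ≤ n + 1 - k) :
    Kr K Finset.univ (w K n n (fun j => ∑ i, expMul K (lam i) (q i) j)) k = siegelIdeal K n k := by
  refine (Submodule.eq_of_le_of_finrank_eq (siegelIdeal_le_Kr_w K n k _) ?_).symm
  have h1 := finrank_Kr_w_expMul_sum_add_of_le K hlam hq hqP hkD hDn
  have h2 := finrank_siegelIdeal K (n := n) k
  omega

/-- in particular two finite nodes of total order `P + P′ + 2 ≥ k + 1` (`≤ n + 1 − k`): `Kr = SI_k` — the regime F1's law leaves as `SI_k ⊔ Gs(xyRich) = SI_k`. -/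
theorem Kr_w_expMul_add_expMul_eq_siegelIdeal {k : ℕ} {lam mu : K} (h : lam ≠ mu) {P P' : ℕ} {q₁ q₂ : ℕ → K}
    (hq₁ : ∀ j, P < j → q₁ j = 0) (hq₁P : q₁ P ≠ 0) (hq₂ : ∀ j, P' < j → q₂ j = 0) (hq₂P : q₂ P' ≠ 0)
    (hkD : k + 1 ≤ P + P' + 2) (hDn : P + P' + 2 ≤ n + 1 - k) :
    Kr K Finset.univ (w K n n (fun j => expMul K lam q₁ j + expMul K mu q₂ j)) k = siegelIdeal K n k := by
  have hlam : Function.Injective (![lam, mu] : Fin 2 → K) := by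
    intro a b hab
    fin_cases a <;> fin_cases b
    · rfl
    · exact absurd hab h
    · exact absurd hab.symm h
    · rfl
  have e : (fun j => expMul K lam q₁ j + expMul K mu q₂ j) = fun j => ∑ i : Fin 2, expMul K (![lam, mu] i) (![q₁, q₂] i) j := by
    funext j; simp [Fin.sum_univ_two]
  have hsum : ∑ i : Fin 2, (![P, P'] i + 1) = P + P' + 2 := by simp [Fin.sum_univ_two]; ring
  rw [e]
  exact Kr_w_expMul_sum_eq_siegelIdeal K hlam (P := ![P, P']) (fun i j hj => by fin_cases i <;> simp_all) (fun i => by fin_cases i <;> simp_all)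
    (by rw [hsum]; exact hkD) (by rw [hsum]; exact hDn)

end Summit.Ventures.HSemireg.Wedge.HankelFrameChange
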